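import Summits.ResolutionOfSingularities.ResolutionOfSingularities.Theorems.WildQuotientsSummitReductionStubPairQuasiSplitNormalFormLemmas5
import Summits.ResolutionOfSingularities.ResolutionOfSingularities.Theorems.WildQuotientsSummitReductionStubPairQuasiSplitNormalFormLemmas3
import Literature.AlgebraicGeometry.Resolution.AlterationsFormalNodesRegular
import HarnessLib

/-!
# `WildQuotients.SummitReduction` (stmt-ResolutionOfSingularities-16324), line `FramePerfect`, skeleton v8:
# stub `stub_pair_quasiSplitNormalForm` (N) — helper file 6: de Jong 1996, 4.25 (i) at the REGULAR
# closed points of `Sing(f)` of a quasi-split semi-stable pair ("if `Σ nᵢ = 1`, then the point `x` is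
# regular on `X`"), over an arbitrary field, in the `IsSNCIdeal` form

Route `ResolutionOfSingularities/WildQuotients`, crux `SummitReduction`; sub-goals of the registered
stub `stub_pair_quasiSplitNormalForm` of the line skeleton `Cruxes/SummitReduction/Lines/FramePerfect.lean`
(v8, lead c4). Worker file.

At a closed point `x ∈ Z` at which `f` is not smooth but `𝒪_{X,x}` is regular, de Jong 1996, 3.3
gives `𝒪̂_{X,x} ≅ A⟦u, v⟧/(uv - t₁)` (`Σ nᵢ = 1`) and `Z = f⁻¹(D)` is `uv · t₂ ⋯ t_r = 0`, a normal
crossings divisor at `x` (4.24/4.25 (i)). The tree proves the formal version over an algebraically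
closed field (`SemiStablePair.exists_ringEquiv_completedStalkIdeal_of_not_smooth`,
`AlterationsFormalNodesRegular.lean`) from the split nodal structure. Here the same computation is run
on the QUASI-SPLIT nodal structure of `…Lemmas3.lean` (`𝒪̂_{X,x} ≅ κ(f x)⟦u, v, T⟧/(uv - ∏ Tᵢ^{νᵢ})`;
regularity forces `ν = δ_{i₀}`, `FormalNodeRing.exists_eq_single_of_isRegularLocalRing`), and
concluded directly in `𝒪̂_{X,x}`: `u, v, (Tᵢ)_{i ≠ i₀}` is a regular system of parameters of the
regular `𝒪̂_{X,x}` and the completed ideal of `Z` is `(u · v · ∏_{i<ρ, i≠i₀} Tᵢ)`, the product of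
its first `ρ + 1` members — local strict normal crossings data (`IsSNCIdeal`), as required by
`DeJong1997.QuasiSplitNormalFormPair.isSNCIdeal_completedStalkIdeal`.

* `isSNCIdeal_completedStalkIdeal_boundary_of_not_smooth` — 4.25 (i) at a regular closed point of
  `Sing(f) ∩ Z` carrying a quasi-split datum.
-/

set_option linter.dupNamespace false

noncomputable section

open CategoryTheory CategoryTheory.Limits AlgebraicGeometry TopologicalSpace Topology
open Literature.AlgebraicGeometry.Resolution
open Literature.AlgebraicGeometry
open IsLocalRing Scheme.IdealSheafData DeJong1996

namespace Summit.ResolutionOfSingularities.ResolutionOfSingularities.Theorems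

universe u

/-- **de Jong 1996, 4.25 (i) at a regular closed point of `Sing(f)`, over an arbitrary field, for a
QUASI-SPLIT semi-stable pair.** For a pair in Situation 4.23, a point `x ∈ Z` with `𝒪_{X,x}`
regular at which `f` is smooth on no neighbourhood, carrying a quasi-split datum (e.g. a closed
point of the line's quasi-split pairs): the completed
ideal of `Z = ⋃ τᵢ(Y) ∪ f⁻¹(D)` in `𝒪̂_{X,x}` has local strict normal crossings data. Proof: the
quasi-split nodal structure `e : 𝒪̂_{X,x} ≅ K⟦u, v, T⟧/(uv - ∏ Tᵢ^{νᵢ})` on a regular system of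
parameters of `𝒪_{Y,f x}` adapted to `D` (`exists_formalNodeRing_equiv_of_quasiSplit`); regularity
gives `ν = δ_{i₀}` with `i₀ < ρ`; then `w = (u, v, (Tᵢ)_{i ≠ i₀})` pulled back along `e` is a regular
system of parameters of `𝒪̂_{X,x}`, `T_{i₀} = uv`, and `Î_Z = (∏_{i<ρ} Tᵢ) = (∏_{j<ρ+2} w_j)`
(the stalk `I(Z)_x = √(f^#(t₁ ⋯ t_ρ))` of `stalkIdeal_semiStableBoundary_of_not_smooth` is
already `(f^#(t₁ ⋯ t_ρ))`, its extension to the faithfully flat `𝒪̂_{X,x}` being the radical ideal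
`(∏_{j<ρ+2} w_j)`). The tree's `exists_ringEquiv_completedStalkIdeal_of_not_smooth` up to its last
step (Cohen coordinates), which the `IsSNCIdeal` form does not need.
[cite: DeJong1996, 3.3 and 4.24–4.25 (i), pp. 63, 75] -/
theorem isSNCIdeal_completedStalkIdeal_boundary_of_not_smooth {k : Type u} [Field k]
    {X Y : Scheme.{u}} {f : X ⟶ Y} {g : Y ⟶ Spec (.of k)} {D : Set Y} {n : ℕ} {τ : Fin n → (Y ⟶ X)}
    (hS : DeJong1996.SemiStablePair f g D τ) {x : X}
    (hreg : IsRegularLocalRing (X.presheaf.stalk x)) (hxZ : x ∈ DeJong1996.semiStableBoundary f D τ)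
    (hns : ∀ U : X.Opens, x ∈ U → ¬ Smooth (U.ι ≫ f))
    (e₁ : AdicCompletion
        ((maximalIdeal (X.presheaf.stalk x)).map (Ideal.Quotient.mk
          ((maximalIdeal (Y.presheaf.stalk (f x))).map (f.stalkMap x).hom)))
        (X.presheaf.stalk x ⧸ (maximalIdeal (Y.presheaf.stalk (f x))).map (f.stalkMap x).hom) ≃+*
      MvPowerSeries (Fin 2) (Y.presheaf.stalk (f x) ⧸ maximalIdeal (Y.presheaf.stalk (f x))) ⧸
        Ideal.span {(MvPowerSeries.X 0 * MvPowerSeries.X 1 :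
          MvPowerSeries (Fin 2) (Y.presheaf.stalk (f x) ⧸ maximalIdeal (Y.presheaf.stalk (f x))))})
    (he₁ : e₁.toRingHom.comp ((algebraMap (X.presheaf.stalk x ⧸
        (maximalIdeal (Y.presheaf.stalk (f x))).map (f.stalkMap x).hom) _).comp
        (Ideal.quotientMap ((maximalIdeal (Y.presheaf.stalk (f x))).map (f.stalkMap x).hom)
          (f.stalkMap x).hom Ideal.le_comap_map)) =
      algebraMap (Y.presheaf.stalk (f x) ⧸ maximalIdeal (Y.presheaf.stalk (f x))) _)
    (V : X.affineOpens) (hV : x ∈ (V : X.Opens)) :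
    IsSNCIdeal (completedStalkIdeal (vanishingIdeal ⟨DeJong1996.semiStableBoundary f D τ,
      hS.isClosed_semiStableBoundary⟩) x V hV) := by
  classical
  haveI := hS.isIntegral
  haveI := hS.locallyOfFiniteType
  haveI := hS.isNoetherian
  haveI := hreg
  haveI : IsRegularLocalRing (AdicCompletion (maximalIdeal (X.presheaf.stalk x)) (X.presheaf.stalk x)) :=
    isRegularLocalRing_adicCompletion (X.presheaf.stalk x)
  haveI : IsDomain (AdicCompletion (maximalIdeal (X.presheaf.stalk x)) (X.presheaf.stalk x)) :=
    isDomain_of_isRegularLocalRing _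
  -- the base parameters and the quasi-split nodal structure
  have hxD : f x ∈ D := hS.apply_mem_of_not_smooth hns hxZ
  obtain ⟨m, ρ, t, hρm, hdimA, hspanA, hIA, hρ⟩ := hS.exists_rsop_stalkIdeal_base' (f x)
  obtain ⟨ρ, rfl⟩ : ∃ ρ', ρ = ρ' + 1 := ⟨ρ - 1, by have := hρ hxD; omega⟩
  obtain ⟨ν, e, hν, he⟩ := exists_formalNodeRing_equiv_of_quasiSplit hS e₁ he₁ t hspanA hdimA hIA
  clear he₁ e₁
  -- regularity: `ν = δ_{i₀}`, `dim 𝒪̂_{X,x} = m + 1`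
  obtain ⟨i₀, hνi₀, hdimBh⟩ := FormalNodeRing.exists_eq_single_of_isRegularLocalRing e
  have hi₀ρ : i₀.val < ρ + 1 := by
    by_contra h
    have := hν i₀ (not_lt.mp h)
    rw [hνi₀, Pi.single_eq_same] at this
    exact one_ne_zero this
  obtain ⟨m, rfl⟩ : ∃ m', m = m' + 1 := ⟨m - 1, by have := i₀.isLt; omega⟩
  -- the generators `a = u`, `b = v`, `cᵢ = Tᵢ` of `𝔪_{𝒪̂}` pulled back along `e`
  set mk := Ideal.Quotient.mk (Ideal.span {formalNodeRelation (ResidueField (Y.presheaf.stalk (f x)))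
    (m + 1) ν}) with hmk
  set a : AdicCompletion (maximalIdeal (X.presheaf.stalk x)) (X.presheaf.stalk x) :=
    e.symm (mk (MvPowerSeries.X (Sum.inl 0))) with ha
  set b : AdicCompletion (maximalIdeal (X.presheaf.stalk x)) (X.presheaf.stalk x) :=
    e.symm (mk (MvPowerSeries.X (Sum.inl 1))) with hb
  set c : Fin (m + 1) → AdicCompletion (maximalIdeal (X.presheaf.stalk x)) (X.presheaf.stalk x) :=
    fun i => e.symm (mk (MvPowerSeries.X (Sum.inr i))) with hc
  have hct : ∀ i, c i = algebraMap (X.presheaf.stalk x) _ ((f.stalkMap x).hom (t i)) := fun i => by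
    rw [hc]
    dsimp only
    rw [← he i, RingEquiv.symm_apply_apply]
  have hν0 : ∃ i, ν i ≠ 0 := ⟨i₀, by rw [hνi₀, Pi.single_eq_same]; exact one_ne_zero⟩
  haveI := FormalNodeRing.isLocalRing (ResidueField (Y.presheaf.stalk (f x))) (m + 1) hν0
  have hgen : Ideal.span ({a, b} ∪ Set.range c) =
      maximalIdeal (AdicCompletion (maximalIdeal (X.presheaf.stalk x)) (X.presheaf.stalk x)) := by
    have h1 : maximalIdeal (AdicCompletion (maximalIdeal (X.presheaf.stalk x)) (X.presheaf.stalk x)) =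
        (maximalIdeal (FormalNodeRing (ResidueField (Y.presheaf.stalk (f x))) (m + 1) ν)).map e.symm :=
      (map_ringEquiv_maximalIdeal e.symm).symm
    rw [h1, FormalNodeRing.maximalIdeal_eq_span (ResidueField (Y.presheaf.stalk (f x))) (m + 1) hν0,
      Ideal.map_span, ← Set.range_comp]
    congr 1
    ext y
    simp only [Set.mem_union, Set.mem_insert_iff, Set.mem_singleton_iff, Set.mem_range,
      Function.comp_apply]
    constructor
    · rintro ((rfl | rfl) | ⟨i, rfl⟩)
      · exact ⟨Sum.inl 0, rfl⟩
      · exact ⟨Sum.inl 1, rfl⟩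
      · exact ⟨Sum.inr i, rfl⟩
    · rintro ⟨j, rfl⟩
      rcases j with j | i
      · fin_cases j
        · exact Or.inl (Or.inl rfl)
        · exact Or.inl (Or.inr rfl)
      · exact Or.inr ⟨i, rfl⟩
  -- the relation: `c_{i₀} = a b`
  have hrel : c i₀ = a * b := by
    have h1 : mk (MvPowerSeries.X (Sum.inr i₀)) =
        mk (MvPowerSeries.X (Sum.inl 0)) * mk (MvPowerSeries.X (Sum.inl 1)) := by
      rw [hmk, FormalNodeRing.mk_X_mul_X, hνi₀]
      congr 1
      rw [Finset.prod_eq_single i₀ (fun i _ hi => by rw [Pi.single_apply, if_neg hi, pow_zero])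
        (fun h => (h (Finset.mem_univ _)).elim), Pi.single_eq_same, pow_one]
    rw [ha, hb, ← map_mul, ← h1]
  have hci₀ : c i₀ ∈ Ideal.span {a} := by
    rw [hrel]
    exact Ideal.mul_mem_right b _ (Ideal.mem_span_singleton_self a)
  -- `w = (a, b, (cᵢ)_{i ≠ i₀})` is a regular system of parameters of `𝒪̂_{X,x}`
  set w : Fin (m + 2) → AdicCompletion (maximalIdeal (X.presheaf.stalk x)) (X.presheaf.stalk x) :=
    Fin.cons a (Fin.cons b (c ∘ i₀.succAbove)) with hw
  have hwspan : Ideal.span (Set.range w) =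
      maximalIdeal (AdicCompletion (maximalIdeal (X.presheaf.stalk x)) (X.presheaf.stalk x)) := by
    rw [hw, Ideal.span_range_node_eq a b c i₀ hci₀, hgen]
  have hdimBh' : ringKrullDim (AdicCompletion (maximalIdeal (X.presheaf.stalk x)) (X.presheaf.stalk x)) =
      ((m + 2 : ℕ) : ℕ) := hdimBh
  have hwp : ∀ j, Prime (w j) := fun j => prime_of_rsop w hwspan hdimBh' j
  have hwn : ∀ j j', j ≠ j' → ¬ w j ∣ w j' := fun j j' h => not_dvd_of_rsop w hwspan hdimBh' h
  -- the product `∏_{i<ρ+1} f^#(tᵢ)` becomes `∏_{j<ρ+2} w_j` in `𝒪̂_{X,x}`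
  set α : X.presheaf.stalk x :=
    ∏ i ∈ Finset.univ.filter (fun i : Fin (m + 1) => i.val < ρ + 1), (f.stalkMap x).hom (t i) with hα
  have hαw : algebraMap (X.presheaf.stalk x)
      (AdicCompletion (maximalIdeal (X.presheaf.stalk x)) (X.presheaf.stalk x)) α =
      ∏ j ∈ Finset.univ.filter (fun j : Fin (m + 2) => j.val < ρ + 1 + 1), w j := by
    rw [hw, Fin.prod_filter_lt_cons, Fin.prod_filter_lt_cons, hα, map_prod]
    simp_rw [← hct]
    rw [← Finset.mul_prod_erase _ _ (Finset.mem_filter.mpr ⟨Finset.mem_univ i₀, hi₀ρ⟩), hrel,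
      mul_assoc, SemiStablePair.prod_filter_erase_eq_prod_succAbove c i₀ ρ hi₀ρ]
    rfl
  -- `(α)` is radical in `𝒪_{X,x}`: its extension to the faithfully flat `𝒪̂_{X,x}` is radical
  have hradBh : (Ideal.span {∏ j ∈ Finset.univ.filter (fun j : Fin (m + 2) => j.val < ρ + 1 + 1),
      w j}).radical = Ideal.span {∏ j ∈ Finset.univ.filter
        (fun j : Fin (m + 2) => j.val < ρ + 1 + 1), w j} :=
    Ideal.radical_span_singleton_prod_eq w _ (fun j _ => hwp j) (fun j _ j' _ h => hwn j j' h)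
  haveI : Module.FaithfullyFlat (X.presheaf.stalk x)
      (AdicCompletion (maximalIdeal (X.presheaf.stalk x)) (X.presheaf.stalk x)) :=
    Module.FaithfullyFlat.of_flat_of_isLocalHom
  have hradα : (Ideal.span {α}).radical = Ideal.span {α} := by
    refine le_antisymm (fun z hz => ?_) Ideal.le_radical
    rw [← Ideal.comap_map_eq_self_of_faithfullyFlat
      (B := AdicCompletion (maximalIdeal (X.presheaf.stalk x)) (X.presheaf.stalk x)) (Ideal.span {α}),
      Ideal.mem_comap, Ideal.map_span, Set.image_singleton, hαw, ← hradBh]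
    obtain ⟨N, hN⟩ := (Ideal.mem_radical_iff.mp hz)
    refine Ideal.mem_radical_iff.mpr ⟨N, ?_⟩
    have h := Ideal.mem_map_of_mem (algebraMap (X.presheaf.stalk x)
      (AdicCompletion (maximalIdeal (X.presheaf.stalk x)) (X.presheaf.stalk x))) hN
    rwa [map_pow, Ideal.map_span, Set.image_singleton, hαw] at h
  -- the stalk of the ideal of `Z` at `x` is `(α)`
  have hIZ : stalkIdeal (vanishingIdeal ⟨semiStableBoundary f D τ,
      hS.isClosed_semiStableBoundary⟩) x = Ideal.span {α} := by
    rw [hS.stalkIdeal_semiStableBoundary_of_not_smooth hns, hIA, Ideal.map_span,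
      Set.image_singleton, map_prod, ← hα, hradα]
  -- conclusion
  rw [completedStalkIdeal_eq_map_stalkIdeal, hIZ, Ideal.map_span, Set.image_singleton, hαw]
  exact isSNCIdeal_span_prod_filter_lt w hwspan hdimBh' (by omega) (by omega) rfl

end Summit.ResolutionOfSingularities.ResolutionOfSingularities.Theorems

end
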